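import Summits.QuantumFields.YangMills.Theorems.BalabanUVNodesN19TargetAtRecord13CoPH
import Summits.QuantumFields.YangMills.Theorems.BalabanUVNodesSpineCarriersOfRecord13CoPHKeyed
import Summits.QuantumFields.YangMills.Theorems.BalabanUVNodesRateCarriersOfRecord13CoPH

/-! v1.7 `CoPH` EDITION (FINDING №9∕LOCATED-9; director-ym №183 H1ʰ∕№186 (α)∕№190; def-T FILE 27 p537939 + 28T p539169; KEY-RULE-27 = KEYMAP v1.7 a6cf631b179f3b60; plan rev 24∕25;
dag-lead WORDS-143: K3⁷ = stmt-QuantumFields-20544) of my LANDED v1.6 module 23bᶜᵒᴾᴿ-era file (23bᶜᵒᴾᴿ p539291, STANDS): the SAME bytes under T₇ (`copr2coph_tokmap.py`: `CoPR ↦ CoPH`,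
`Stage13RParams ↦ Stage13HParams` (whole-history slots `Zh`∕`Phih`), `ZrUnity ↦ ZhUnity`, RR-2 guard `unityNondeg₁₃R ↦ unityNondeg₁₃H` (`Record13DatumKeyCoPH` p539151), not-re-issued letters at
`θ.toStage13Params` via the two-level `extends`; 16 thm, 0 def) over the v1.7 homes of record (dag-n27-c `…SpineCarriersOfRecord13CoPH`∕`…N27AtRecord13CoPHHome(On)`, dag-n22-e
`…RateCarriersOfRecord13CoPH(On)`, my 23ᶜᵒᴾᴴ p543022) consumed BY NAME.  Filed `--kind proof --supports stmt-QuantumFields-20544 --as helper`.  COUNT-NEUTRAL; every stub∕edge∕reading∕pin a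
HYPOTHESIS; NE7 NOT PRINTED∕proved; N19 0∕1.  Seat `pub-ymgap-dag-n19-d` g9, module 23bᶜᵒᴾᴴ.  Below: older headers under T₇ (edition names substituted; p-ids = ORIGINAL modules). -/
/-!
# BalabanUVNodes ∕ N19 (NE7 proper) — node U5's DECL TARGET AT THE TWO CANONICAL STAGE-13 CARRIER HOMES: the spine-carrier home (T-SPINE)₁₃ `YMDAG.UVSplit.SRec₁₃CoPH cr`
# (tuple-keyed; `canonReading₁₃CoPH cr` datum-keyed — dag-n20-d `…SpineCarriersOfRecord13CoPH(Keyed)` p490271) and the rate-carrier home (T-RATE)₁₃ `YMDAG.UVSplit.RRec₁₃CoPH 𝔯` (datum-keyed,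
# every run length — dag-n22-e `…RateCarriersOfRecord13CoPH`) — the ₁₃ twin of module 8 (`…N19TargetAtHomes12`, p466894), token for token with `12 ↦ 13`

Cell `pub-ymgap` (HUMAN RULING D-0062, Track A), R134 ACCELERATION seat `pub-ymgap-dag-n19-d` (strategy s2 «by-name knit at the record»), gen 7, module 23b.  Director-ym LINE №125 (3)
«the ₁₂ modules re-instantiate at Stage 13»; LINE №138 «K1∕K2∕K3 lane work continues on the ₁₃ objects».  Filed `--kind proof --supports stmt-QuantumFields-19912 --as helper` (K3‴
`SpineGivenEndpointR13`, rev 16∕17).  COUNT-NEUTRAL.  NO Theses import (restate-immune).  dag-n27-c `FIELD-TABLE-R13.md` row h19 «none at ₁₃ yet … their ₁₃ re-key» — continued.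

WHAT IS INSTANTIATED ∕ RE-KEYED (12 ↦ 13, by name).
* §1 AT THE TUPLE-KEYED SPINE HOME `SRec₁₃CoPH cr` ((T-SPINE)₁₃ `sRec₁₃CoPH_iff` is `Iff.rfl` and IS module 6b's characterisation `hkeyS` at the Stage-13 key with `cr := fun θ h ↦ cr F θ h`): the
  director's R134 row under the interim pin (`s_U4_sRec₁₃CoPH_iff_lt_one_of_pin`, `s_N19_sRec₁₃CoPH_iff_coreEdge_of_pin`, `hybridNE7_at_sRec₁₃CoPH_of_pin` — `summable := summable_deltaOfRecord`
  DISPLAYED content-free), the literal :183 road and K4 consumed — each ONE application of module 6b ∕ 23.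
* §2 AT THE PAIR OF HOMES: the master faces for pair binders at `(SRec₁₃CoPH cr, RRec₁₃CoPH 𝔯)` and at the CANONICAL pair `(SRec₁₃CoPH (canonReading₁₃CoPH cr), RRec₁₃CoPH 𝔯)` (both datum-keyed by RR-2's
  `Node00.IsDatumOfRecord₁₃CCoPH`, ONE parameter `h.params` for both bundles), the N19′ edge binder read honestly at the two homes, the SAME-KEY edge, and its supply from the θ-form
  (`IsDatumOfRecord₁₃CCoPH.forall_params`).  (n27-c XXXVIII `coreEdge_of_homes₁₃CoPH` is the B5-side consumer of the same pair-form binder.)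
* §3 N19's DECL TARGET AT BOTH HOMES: from the six in-edges BY NAME at `RRec₁₃CoPH 𝔯` (n22-e's `s_N1x_rRec₁₃CoPH_iff` faces; K4's existence stub is n22-e's THEOREM `s_R00x_rRec₁₃CoPH`, CONSUMED),
  the spine stubs at the canonical spine home and the same-key edge; the `lt_one`-filled literal road; the canonical transfers of the children's θ-form products; and §3′ the GUARDED
  θ-KEYED B5 FORM (rev 16's K3‴ shape: `∀ θ h, G θ → θ.Admissible → … HybridNE7Under (datumOfRecord₁₃CoPH F N θ h) END`, any guard `G`, e.g. `Node00.unityNondeg₁₃ N`) read off the homes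
  through module 23's guarded faces.  The REGIME-RESTRICTED homes `SRec₁₃CoPHOn` ∕ `RRec₁₃CoPHOn` (guard INSIDE the stubs, read AT θ) are module 24.

HONEST FRAMING.  Bookkeeping: one-application instances and textual re-keys; `cr`, `𝔯` are RESIDUAL readings (parameters; no reading of Bałaban's dressed two-run expansion off the
record exists — dag-n20-e LOCATED (F1)–(F4)); every stub, pin and edge is a HYPOTHESIS with no producer at the Stage-13 homes today (0∕1); nothing of Bałaban's is asserted or
instantiated; NE7 ∕ NE7b ∕ NE7c NOT PRINTED for d = 4, NOT PROVED; the N19 CONTENT (the same-key ∃δ-edge `h19` at pinned `cr` ∕ `𝔯`) is untouched; NO node is discharged; K3‴ NOT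
claimed; whether ₁₃C is inhabited is K0‴ (open, HOLD №136∕138; nothing here reads `Provisos₁₃CoPH.bg`); counts UNMOVED (typed 28∕28 · discharged 5∕27, A 5∕28); one finite four-torus
programme at fixed `ε = L^{−K}` — NOT ℝ⁴, NOT infinite volume, NOT OS, NOT a mass gap, NOT Clay.  0 `def`, 0 `sorry`; no cite tags (bookkeeping [folklore]).
-/

open Finset

namespace Summit.QuantumFields.YangMills.BalabanUVNodes.N19TargetAtHomes13CoPH

open Literature.MathematicalPhysics.QuantumFieldTheory.Balaban1983to89
open Literature.MathematicalPhysics.QuantumFieldTheory.Balaban1983to89.T4Continuum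
open T4WeightBudget (RelWeightBound)
open T4IndicatorShell (ShellWeightBound)
open T4MatchingAssembly (HybridNE7)
open T4CauchySum (MatchingModConstants)
open T4ContinuumYM4Torus (ForSmallCouplings)
open T4ApexVariance (MatchingUnder)
open Summit.QuantumFields.BalabanUV.T4Continuum.Spine
open Summit.QuantumFields.YangMills.BalabanUVNodes.N19AtSpineCarriers (deltaOfRecord summable_deltaOfRecord core_deltaOfRecord)
open Summit.QuantumFields.YangMills.BalabanUVNodes.N19TargetKeyed (s_U4_keyed_iff_lt_one_of_pin)
open Summit.QuantumFields.YangMills.BalabanUVNodes.N19TargetAtRecord13CoPH (avgMeasurable_of_isRecordOfRecord₁₃CCoPH matchingUnder_at_record₁₃CoPH_of_rateStubs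
  s_N19_keyed₁₃CoPH_iff_coreEdge_of_pin hybridNE7_at_keyed₁₃CoPH_of_pin matching_at_record₁₃CoPH_of_coreEdge matchingUnder_at_record₁₃CoPH_of_spineRates
  forall_guarded_matchingUnder_datumOfRecord₁₃CoPH_iff forall_guarded_matchingUnder_datumOfRecord₁₃CoPH_of_forall_record₁₃CoPH)
open Summit.QuantumFields.YangMills.Theorems.BalabanUVNodesN27SpineRecord (spine_of_rateStubs_coreEdge)
open YMDAG.UVSplit
open Node00 (Stage13HParams datumOfRecord₁₃CoPH IsRecordOfRecord₁₃CCoPH IsDatumOfRecord₁₃CCoPH)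

variable {N : ℕ} [NeZero N] (cr : SpineReading₁₃CoPH N) (𝔯 : RateReading₁₃CoPH N) (Inputs : InputsPred N)

/-! ## §1 At the tuple-keyed spine home `SRec₁₃CoPH cr`: the director's row under the pin, the :183 road — module 6b∕7 instances (`hkeyS := sRec₁₃CoPH_iff`) -/

section SpineHome

variable
  (hpin : ∀ (F : T4Family) (θ : Stage13HParams F N) (hP : θ.Provisos₁₃CoPH F N), θ.Admissible F N → ∀ (g₀ : ℕ → ℝ) (os : List (ULoop F)),
    letI := (cr F θ hP g₀ os).dec
    (cr F θ hP g₀ os).δ = deltaOfRecord (cr F θ hP g₀ os).l₀ (cr F θ hP g₀ os).vol (cr F θ hP g₀ os).T (cr F θ hP g₀ os).Bad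
      (fun K t τ => (cr F θ hP g₀ os).A K t τ - (cr F θ hP g₀ os).shA K t τ) (fun K t τ => (cr F θ hP g₀ os).B K t τ - (cr F θ hP g₀ os).shB K t τ))
include hpin

/-- **U4′ AT THE STAGE-13 SPINE HOME UNDER THE PIN IS ITS BUDGET HALF ALONE** [bookkeeping] (module 6b `s_U4_keyed_iff_lt_one_of_pin` at `hkeyS := sRec₁₃CoPH_iff`): the δ-half
`Summable (cr …).δ` is `summable_deltaOfRecord` — TRUE BY CONSTRUCTION, DISPLAYED, never progress. [folklore] -/
theorem s_U4_sRec₁₃CoPH_iff_lt_one_of_pin :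
    S_U4 (SRec₁₃CoPH cr) ↔ ∀ (F : T4Family) (θ : Stage13HParams F N) (hP : θ.Provisos₁₃CoPH F N), θ.Admissible F N → ∀ (g₀ : ℕ → ℝ) (os : List (ULoop F)) (K : ℕ),
      (cr F θ hP g₀ os).W K + (cr F θ hP g₀ os).Wsh K < 1 :=
  s_U4_keyed_iff_lt_one_of_pin (Θ := fun F => Stage13HParams F N) (fun θ => θ.Provisos₁₃CoPH _ N) (fun θ => θ.Admissible _ N) (fun θ h => datumOfRecord₁₃CoPH _ N θ h)
    (SRec₁₃CoPH cr) (fun θ h => cr _ θ h) (fun _ D g₀ os S => sRec₁₃CoPH_iff cr D g₀ os S) hpin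

/-- **THE K5 STUB `S_N19` AT THE STAGE-13 SPINE HOME UNDER THE PIN IS THE KEYED ∃δ-EDGE** [bookkeeping] (module 23 `s_N19_keyed₁₃CoPH_iff_coreEdge_of_pin` at `sRec₁₃CoPH_iff`; compare
n20-d's `s_N19_sRec₁₃CoPH_iff`, Core at the reading's OWN `δ`).  THE WHOLE N19 CONTENT AT STAGE 13 IS THAT EDGE. [folklore] -/
theorem s_N19_sRec₁₃CoPH_iff_coreEdge_of_pin :
    S_N19 (SRec₁₃CoPH cr) Inputs ↔ ∀ (F : T4Family) (θ : Stage13HParams F N) (hP : θ.Provisos₁₃CoPH F N), θ.Admissible F N → ∀ (g₀ : ℕ → ℝ) (os : List (ULoop F)),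
      Inputs F (datumOfRecord₁₃CoPH F N θ hP) g₀ os → letI := (cr F θ hP g₀ os).dec
      ∃ δ : ℕ → ℝ, NE7.Core (cr F θ hP g₀ os).l₀ (cr F θ hP g₀ os).vol (cr F θ hP g₀ os).T (cr F θ hP g₀ os).Bad
        (fun K t τ => (cr F θ hP g₀ os).A K t τ - (cr F θ hP g₀ os).shA K t τ) (fun K t τ => (cr F θ hP g₀ os).B K t τ - (cr F θ hP g₀ os).shB K t τ) δ ∧
        Summable δ :=
  s_N19_keyed₁₃CoPH_iff_coreEdge_of_pin (SRec₁₃CoPH cr) Inputs (fun θ h => cr _ θ h) (fun _ D g₀ os S => sRec₁₃CoPH_iff cr D g₀ os S) hpin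

/-- **`HybridNE7` FIELD BY FIELD AT THE STAGE-13 SPINE HOME, UNDER THE PIN** [bookkeeping] — the director's R134 row at `SRec₁₃CoPH cr` (module 23 `hybridNE7_at_keyed₁₃CoPH_of_pin`):
`weight := S_N20 (SRec₁₃CoPH cr)` · `shell := S_N21 (SRec₁₃CoPH cr)` · `lt_one :=` the keyed budget half · `summable := summable_deltaOfRecord` (CONTENT-FREE, DISPLAYED) ·
`core := S_N19 (SRec₁₃CoPH cr) Inputs`. [folklore] -/
theorem hybridNE7_at_sRec₁₃CoPH_of_pin (h20 : S_N20 (SRec₁₃CoPH cr)) (h21 : S_N21 (SRec₁₃CoPH cr))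
    (hlt : ∀ (F : T4Family) (θ : Stage13HParams F N) (hP : θ.Provisos₁₃CoPH F N), θ.Admissible F N → ∀ (g₀ : ℕ → ℝ) (os : List (ULoop F)) (K : ℕ),
      (cr F θ hP g₀ os).W K + (cr F θ hP g₀ os).Wsh K < 1)
    (h19 : S_N19 (SRec₁₃CoPH cr) Inputs) {F : T4Family} {D : Datum F N} {g₀ : ℕ → ℝ} {os : List (ULoop F)} {S : SpineCarriers} (hS : SRec₁₃CoPH cr F D g₀ os S)
    (hI : Inputs F D g₀ os) : letI := S.dec
    HybridNE7 S.l₀ S.vol S.T S.A S.B S.Bad S.W S.shA S.shB S.Wsh S.δ :=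
  hybridNE7_at_keyed₁₃CoPH_of_pin (SRec₁₃CoPH cr) Inputs (fun θ h => cr _ θ h) (fun _ D g₀ os S => sRec₁₃CoPH_iff cr D g₀ os S) hpin h20 h21 hlt h19 hS hI

omit hpin

/-- **THE LITERAL :183 ROAD AT THE STAGE-13 SPINE HOME, GUARDED BY K4's CONCLUSION** [bookkeeping] (module 8 `matching_at_record₁₂_sRec₁₂_of_coreEdge` at Stage 13; module 23
`matching_at_record₁₃CoPH_of_coreEdge` with N19's two binders KEYED AT THE TUPLES). [folklore] -/
theorem matching_at_record₁₃CoPH_sRec₁₃CoPH_of_coreEdge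
    (hx : S_N27x (fun F D w => IsRecordOfRecord₁₃CCoPH F N D w) (SRec₁₃CoPH cr)) (h20 : S_N20 (SRec₁₃CoPH cr)) (h21 : S_N21 (SRec₁₃CoPH cr))
    (hlt : ∀ (F : T4Family) (θ : Stage13HParams F N) (hP : θ.Provisos₁₃CoPH F N), θ.Admissible F N → ∀ (g₀ : ℕ → ℝ) (os : List (ULoop F)) (K : ℕ),
      (cr F θ hP g₀ os).W K + (cr F θ hP g₀ os).Wsh K < 1)
    (hedge : ∀ (F : T4Family) (θ : Stage13HParams F N) (hP : θ.Provisos₁₃CoPH F N), θ.Admissible F N → ∀ (g₀ : ℕ → ℝ) (os : List (ULoop F)),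
      Inputs F (datumOfRecord₁₃CoPH F N θ hP) g₀ os → letI := (cr F θ hP g₀ os).dec
      ∃ δ : ℕ → ℝ, NE7.Core (cr F θ hP g₀ os).l₀ (cr F θ hP g₀ os).vol (cr F θ hP g₀ os).T (cr F θ hP g₀ os).Bad
        (fun K t τ => (cr F θ hP g₀ os).A K t τ - (cr F θ hP g₀ os).shA K t τ) (fun K t τ => (cr F θ hP g₀ os).B K t τ - (cr F θ hP g₀ os).shB K t τ) δ ∧
        Summable δ)
    {F : T4Family} {D : Datum F N} {w : DagBinding.WorldP} (hR : IsRecordOfRecord₁₃CCoPH F N D w)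
    (hB : B16.EndStatementBPrinted D.C) (hE : DagBinding.EndpointExistence D.C.toB12) :
    ForSmallCouplings D fun g₀ => ∀ os : List (ULoop F), Inputs F D g₀ os →
      ∃ (l₀ vol : ℝ) (δ' : ℕ → ℝ), 0 < l₀ ∧ Summable δ' ∧ MatchingModConstants vol l₀ δ' (T4GenFunBounds.schemeZ (D.scheme g₀) os) :=
  matching_at_record₁₃CoPH_of_coreEdge (SRec₁₃CoPH cr) Inputs hx h20 h21
    (by
      rintro F D g₀ os S ⟨θ, hP, hθ, rfl, rfl⟩
      exact hlt F θ hP hθ g₀ os)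
    (by
      rintro F D g₀ os S ⟨θ, hP, hθ, rfl, rfl⟩ hI
      exact hedge F θ hP hθ g₀ os hI)
    hR hB hE

/-- **… K4's HOOK CONSUMED: `MatchingUnder D END` AT EVERY STAGE-13 RECORD** [bookkeeping] (module 8 `matchingUnder_at_record₁₂_sRec₁₂_of_spineRates` at Stage 13). [folklore] -/
theorem matchingUnder_at_record₁₃CoPH_sRec₁₃CoPH_of_spineRates
    (hx : S_N27x (fun F D w => IsRecordOfRecord₁₃CCoPH F N D w) (SRec₁₃CoPH cr)) (h20 : S_N20 (SRec₁₃CoPH cr)) (h21 : S_N21 (SRec₁₃CoPH cr))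
    (hlt : ∀ (F : T4Family) (θ : Stage13HParams F N) (hP : θ.Provisos₁₃CoPH F N), θ.Admissible F N → ∀ (g₀ : ℕ → ℝ) (os : List (ULoop F)) (K : ℕ),
      (cr F θ hP g₀ os).W K + (cr F θ hP g₀ os).Wsh K < 1)
    (hedge : ∀ (F : T4Family) (θ : Stage13HParams F N) (hP : θ.Provisos₁₃CoPH F N), θ.Admissible F N → ∀ (g₀ : ℕ → ℝ) (os : List (ULoop F)),
      Inputs F (datumOfRecord₁₃CoPH F N θ hP) g₀ os → letI := (cr F θ hP g₀ os).dec
      ∃ δ : ℕ → ℝ, NE7.Core (cr F θ hP g₀ os).l₀ (cr F θ hP g₀ os).vol (cr F θ hP g₀ os).T (cr F θ hP g₀ os).Bad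
        (fun K t τ => (cr F θ hP g₀ os).A K t τ - (cr F θ hP g₀ os).shA K t τ) (fun K t τ => (cr F θ hP g₀ os).B K t τ - (cr F θ hP g₀ os).shB K t τ) δ ∧
        Summable δ)
    (h4 : SpineRates (fun F D w => IsRecordOfRecord₁₃CCoPH F N D w) Inputs)
    {F : T4Family} {D : Datum F N} {w : DagBinding.WorldP} (hR : IsRecordOfRecord₁₃CCoPH F N D w) :
    MatchingUnder D (DagBinding.EndpointExistence D.C.toB12) :=
  matchingUnder_at_record₁₃CoPH_of_spineRates (SRec₁₃CoPH cr) Inputs hx h20 h21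
    (by
      rintro F D g₀ os S ⟨θ, hP, hθ, rfl, rfl⟩
      exact hlt F θ hP hθ g₀ os)
    (by
      rintro F D g₀ os S ⟨θ, hP, hθ, rfl, rfl⟩ hI
      exact hedge F θ hP hθ g₀ os hI)
    h4 hR

end SpineHome

/-! ## §2 The N19′ edge binder READ AT THE TWO STAGE-13 HOMES (module 8 §2 re-keyed) -/

section Edge

/-- **MASTER FACE FOR THE PAIR (tuple-keyed spine home, datum-keyed rate home), STAGE 13** [bookkeeping]: a clause `P` over the pairs `(S, R)` the two homes pin at the
same `(F, D, g₀, os)` IS the clause at `(cr F θ hP g₀ os, rateCarriersOfRecord₁₃CoPH 𝔯 F h.params h.provisos g₀ os k)` for every admissible θ with provisos, every datum key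
`h` of θ's datum and every run length `k`. [folklore] -/
theorem forall_sRec₁₃CoPH_rRec₁₃CoPH_iff (P : (F : T4Family) → Datum F N → (ℕ → ℝ) → List (ULoop F) → SpineCarriers → RateCarriers N → Prop) :
    (∀ (F : T4Family) (D : Datum F N) (g₀ : ℕ → ℝ) (os : List (ULoop F)) (S : SpineCarriers) (R : RateCarriers N),
        SRec₁₃CoPH cr F D g₀ os S → RRec₁₃CoPH 𝔯 F D g₀ os R → P F D g₀ os S R) ↔
      ∀ (F : T4Family) (θ : Stage13HParams F N) (hP : θ.Provisos₁₃CoPH F N), θ.Admissible F N → ∀ (g₀ : ℕ → ℝ) (os : List (ULoop F))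
        (h : IsDatumOfRecord₁₃CCoPH F N (datumOfRecord₁₃CoPH F N θ hP)) (k : ℕ),
        P F (datumOfRecord₁₃CoPH F N θ hP) g₀ os (cr F θ hP g₀ os) (rateCarriersOfRecord₁₃CoPH 𝔯 F h.params h.provisos g₀ os k) := by
  constructor
  · intro H F θ hP hθ g₀ os h k
    exact H F _ g₀ os _ _ (sRec₁₃CoPH_self cr θ hP hθ g₀ os) ⟨h, k, rfl⟩
  · rintro H F D g₀ os S R ⟨θ, hP, hθ, rfl, rfl⟩ ⟨h, k, rfl⟩
    exact H F θ hP hθ g₀ os h k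

/-- **MASTER FACE FOR THE CANONICAL PAIR (both homes datum-keyed), STAGE 13** [bookkeeping]: a clause `P` over the pairs the CANONICAL spine home and the rate home pin
at the same `(F, D, g₀, os)` IS the clause at `(cr F h.params h.provisos g₀ os, rateCarriersOfRecord₁₃CoPH 𝔯 F h.params h.provisos g₀ os k)` for every datum key `h` and
run length `k` — ONE parameter for both bundles. [folklore] -/
theorem forall_canon_rRec₁₃CoPH_iff (P : (F : T4Family) → Datum F N → (ℕ → ℝ) → List (ULoop F) → SpineCarriers → RateCarriers N → Prop) :
    (∀ (F : T4Family) (D : Datum F N) (g₀ : ℕ → ℝ) (os : List (ULoop F)) (S : SpineCarriers) (R : RateCarriers N),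
        SRec₁₃CoPH (canonReading₁₃CoPH cr) F D g₀ os S → RRec₁₃CoPH 𝔯 F D g₀ os R → P F D g₀ os S R) ↔
      ∀ (F : T4Family) (D : Datum F N) (h : IsDatumOfRecord₁₃CCoPH F N D) (g₀ : ℕ → ℝ) (os : List (ULoop F)) (k : ℕ),
        P F D g₀ os (cr F h.params h.provisos g₀ os) (rateCarriersOfRecord₁₃CoPH 𝔯 F h.params h.provisos g₀ os k) := by
  constructor
  · intro H F D h g₀ os k
    exact H F D g₀ os _ _ ((sRec₁₃CoPH_canon_iff cr D g₀ os _).mpr ⟨h, rfl⟩) ⟨h, k, rfl⟩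
  · intro H F D g₀ os S R hS hR
    obtain ⟨h, rfl⟩ := (sRec₁₃CoPH_canon_iff cr D g₀ os S).mp hS
    obtain ⟨h', k, rfl⟩ := hR
    exact H F D h g₀ os k

/-- **THE EDGE BINDER AT THE TUPLE-KEYED SPINE HOME AND THE DATUM-KEYED RATE HOME, READ HONESTLY, STAGE 13** [bookkeeping]: module 6a's `hedgeR` at `(SRec₁₃CoPH cr, RRec₁₃CoPH 𝔯)` ⟺
«for every admissible Stage-13 θ with provisos, every `g₀`, `os`, every datum key `h` OF θ's DATUM and every run length `k`: the six in-edges at the rate bundle read at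
the CANONICAL parameter give SOME summable `δ` with `Spine.NE7.Core` on the shell-free cores of `cr F θ hP g₀ os`» — θ and `h.params` realise the same datum but need not
coincide (node00-def-RR-2's located point); the same-key form is the next face. [folklore] -/
theorem rateEdge_sRec₁₃CoPH_rRec₁₃CoPH_iff :
    (∀ (F : T4Family) (D : Datum F N) (g₀ : ℕ → ℝ) (os : List (ULoop F)) (S : SpineCarriers) (R : RateCarriers N),
        SRec₁₃CoPH cr F D g₀ os S → RRec₁₃CoPH 𝔯 F D g₀ os R → RatesAt D R → letI := S.dec
        ∃ δ : ℕ → ℝ, NE7.Core S.l₀ S.vol S.T S.Bad (fun K t τ => S.A K t τ - S.shA K t τ) (fun K t τ => S.B K t τ - S.shB K t τ) δ ∧ Summable δ) ↔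
      ∀ (F : T4Family) (θ : Stage13HParams F N) (hP : θ.Provisos₁₃CoPH F N), θ.Admissible F N → ∀ (g₀ : ℕ → ℝ) (os : List (ULoop F))
        (h : IsDatumOfRecord₁₃CCoPH F N (datumOfRecord₁₃CoPH F N θ hP)) (k : ℕ),
        RatesAt (datumOfRecord₁₃CoPH F N θ hP) (rateCarriersOfRecord₁₃CoPH 𝔯 F h.params h.provisos g₀ os k) → letI := (cr F θ hP g₀ os).dec
        ∃ δ : ℕ → ℝ, NE7.Core (cr F θ hP g₀ os).l₀ (cr F θ hP g₀ os).vol (cr F θ hP g₀ os).T (cr F θ hP g₀ os).Bad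
          (fun K t τ => (cr F θ hP g₀ os).A K t τ - (cr F θ hP g₀ os).shA K t τ) (fun K t τ => (cr F θ hP g₀ os).B K t τ - (cr F θ hP g₀ os).shB K t τ) δ ∧
          Summable δ := by
  constructor
  · intro H F θ hP hθ g₀ os h k hr
    exact H F _ g₀ os _ _ (sRec₁₃CoPH_self cr θ hP hθ g₀ os) ⟨h, k, rfl⟩ hr
  · rintro H F D g₀ os S R ⟨θ, hP, hθ, rfl, rfl⟩ ⟨h, k, rfl⟩ hr
    exact H F θ hP hθ g₀ os h k hr

/-- **THE SAME-KEY EDGE AT THE CANONICAL STAGE-13 SPINE HOME** [bookkeeping]: module 6a's `hedgeR` at `(SRec₁₃CoPH (canonReading₁₃CoPH cr), RRec₁₃CoPH 𝔯)` ⟺ «for every family, every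
Stage-13 datum of record `D` with key `h`, every `g₀`, `os`, every run length `k`: the six in-edges `RatesAt D (rateCarriersOfRecord₁₃CoPH 𝔯 F h.params h.provisos g₀ os k)` give
SOME summable `δ` carrying `Spine.NE7.Core` on the shell-free cores of `cr F h.params h.provisos g₀ os`» — spine AND rate carriers read AT THE SAME parameter (one bundle per
datum: `sRec₁₃CoPH_canon_iff`, proof irrelevance of the key).  THIS is the N19′ edge of the join at NODE 00's Stage-13 objects. [folklore] -/
theorem rateEdge_canon_rRec₁₃CoPH_iff :
    (∀ (F : T4Family) (D : Datum F N) (g₀ : ℕ → ℝ) (os : List (ULoop F)) (S : SpineCarriers) (R : RateCarriers N),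
        SRec₁₃CoPH (canonReading₁₃CoPH cr) F D g₀ os S → RRec₁₃CoPH 𝔯 F D g₀ os R → RatesAt D R → letI := S.dec
        ∃ δ : ℕ → ℝ, NE7.Core S.l₀ S.vol S.T S.Bad (fun K t τ => S.A K t τ - S.shA K t τ) (fun K t τ => S.B K t τ - S.shB K t τ) δ ∧ Summable δ) ↔
      ∀ (F : T4Family) (D : Datum F N) (h : IsDatumOfRecord₁₃CCoPH F N D) (g₀ : ℕ → ℝ) (os : List (ULoop F)) (k : ℕ),
        RatesAt D (rateCarriersOfRecord₁₃CoPH 𝔯 F h.params h.provisos g₀ os k) → letI := (cr F h.params h.provisos g₀ os).dec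
        ∃ δ : ℕ → ℝ, NE7.Core (cr F h.params h.provisos g₀ os).l₀ (cr F h.params h.provisos g₀ os).vol (cr F h.params h.provisos g₀ os).T
          (cr F h.params h.provisos g₀ os).Bad
          (fun K t τ => (cr F h.params h.provisos g₀ os).A K t τ - (cr F h.params h.provisos g₀ os).shA K t τ)
          (fun K t τ => (cr F h.params h.provisos g₀ os).B K t τ - (cr F h.params h.provisos g₀ os).shB K t τ) δ ∧ Summable δ := by
  constructor
  · intro H F D h g₀ os k hr
    exact H F D g₀ os _ _ ((sRec₁₃CoPH_canon_iff cr D g₀ os _).mpr ⟨h, rfl⟩) ⟨h, k, rfl⟩ hr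
  · intro H F D g₀ os S R hS hR hr
    obtain ⟨h, rfl⟩ := (sRec₁₃CoPH_canon_iff cr D g₀ os S).mp hS
    obtain ⟨h', k, rfl⟩ := hR
    exact H F D h g₀ os k hr

/-- **THE θ-FORM SUPPLIES THE SAME-KEY EDGE, STAGE 13** [bookkeeping]: if for EVERY admissible Stage-13 θ with provisos, every `g₀`, `os` and run length `k` the six in-edges at
`rateCarriersOfRecord₁₃CoPH 𝔯 F θ hP g₀ os k` on θ's datum give the ∃δ-Core clause on `cr F θ hP g₀ os` (what an N19′ prover states at the Stage-13 objects), then module 6a's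
`hedgeR` holds at `(SRec₁₃CoPH (canonReading₁₃CoPH cr), RRec₁₃CoPH 𝔯)` (RR-2's `IsDatumOfRecord₁₃CCoPH.forall_params`). [folklore] -/
theorem rateEdge_canon_rRec₁₃CoPH_of_forall_admissible
    (h19 : ∀ (F : T4Family) (θ : Stage13HParams F N) (hP : θ.Provisos₁₃CoPH F N), θ.Admissible F N → ∀ (g₀ : ℕ → ℝ) (os : List (ULoop F)) (k : ℕ),
      RatesAt (datumOfRecord₁₃CoPH F N θ hP) (rateCarriersOfRecord₁₃CoPH 𝔯 F θ hP g₀ os k) → letI := (cr F θ hP g₀ os).dec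
      ∃ δ : ℕ → ℝ, NE7.Core (cr F θ hP g₀ os).l₀ (cr F θ hP g₀ os).vol (cr F θ hP g₀ os).T (cr F θ hP g₀ os).Bad
        (fun K t τ => (cr F θ hP g₀ os).A K t τ - (cr F θ hP g₀ os).shA K t τ) (fun K t τ => (cr F θ hP g₀ os).B K t τ - (cr F θ hP g₀ os).shB K t τ) δ ∧
        Summable δ)
    (F : T4Family) (D : Datum F N) (g₀ : ℕ → ℝ) (os : List (ULoop F)) (S : SpineCarriers) (R : RateCarriers N)
    (hS : SRec₁₃CoPH (canonReading₁₃CoPH cr) F D g₀ os S) (hR : RRec₁₃CoPH 𝔯 F D g₀ os R) (hr : RatesAt D R) : letI := S.dec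
    ∃ δ : ℕ → ℝ, NE7.Core S.l₀ S.vol S.T S.Bad (fun K t τ => S.A K t τ - S.shA K t τ) (fun K t τ => S.B K t τ - S.shB K t τ) δ ∧ Summable δ := by
  refine (rateEdge_canon_rRec₁₃CoPH_iff cr 𝔯).mpr (fun F D h g₀ os k => ?_) F D g₀ os S R hS hR hr
  exact IsDatumOfRecord₁₃CCoPH.forall_params
    (P := fun D θ hθ => RatesAt D (rateCarriersOfRecord₁₃CoPH 𝔯 F θ hθ g₀ os k) → letI := (cr F θ hθ g₀ os).dec
      ∃ δ : ℕ → ℝ, NE7.Core (cr F θ hθ g₀ os).l₀ (cr F θ hθ g₀ os).vol (cr F θ hθ g₀ os).T (cr F θ hθ g₀ os).Bad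
        (fun K t τ => (cr F θ hθ g₀ os).A K t τ - (cr F θ hθ g₀ os).shA K t τ) (fun K t τ => (cr F θ hθ g₀ os).B K t τ - (cr F θ hθ g₀ os).shB K t τ) δ ∧
        Summable δ)
    (fun θ hθ hadm => h19 F θ hθ hadm g₀ os k) h

end Edge

/-! ## §3 N19's DECL target at both Stage-13 homes (module 8 §3 re-keyed) -/

section Target

/-- **N19's DECL TARGET AT BOTH STAGE-13 HOMES OF THE RATE-RECORD DIVISION** [bookkeeping]: the six in-edges BY NAME at the (T-RATE) home `RRec₁₃CoPH 𝔯` — `S_N14` · `S_N15` ·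
`S_N16` · `S_N17` · `S_N18` · `S_N22` (each ⟺ «the node's estimate at the canonical Stage-13 objects of every datum of record», n22-e's `s_N1x_rRec₁₃CoPH_iff`; K4's
existence stub `S_R00x ₁₃C (RRec₁₃CoPH 𝔯)` is n22-e's THEOREM `s_R00x_rRec₁₃CoPH`, CONSUMED) — the spine stubs `S_N27x ₁₃C` · `S_N20` · `S_N21` at the CANONICAL spine home
`SRec₁₃CoPH (canonReading₁₃CoPH cr)`, and the SAME-KEY N19′ edge (§2 `rateEdge_canon_rRec₁₃CoPH_iff`'s right side) ⇒ `MatchingUnder D END` at every ₁₃C record (n27-a XIV at the two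
homes, then node U5 at the record by the degenerate expansion). [folklore] -/
theorem matchingUnder_at_homes₁₃CoPH_of_rateStubs
    (h14 : S_N14 (RRec₁₃CoPH 𝔯)) (h15 : S_N15 (RRec₁₃CoPH 𝔯)) (h16 : S_N16 (RRec₁₃CoPH 𝔯)) (h17 : S_N17 (RRec₁₃CoPH 𝔯)) (h18 : S_N18 (RRec₁₃CoPH 𝔯)) (h22 : S_N22 (RRec₁₃CoPH 𝔯))
    (hx : S_N27x (fun F D w => IsRecordOfRecord₁₃CCoPH F N D w) (SRec₁₃CoPH (canonReading₁₃CoPH cr))) (h20 : S_N20 (SRec₁₃CoPH (canonReading₁₃CoPH cr)))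
    (h21 : S_N21 (SRec₁₃CoPH (canonReading₁₃CoPH cr)))
    (h19 : ∀ (F : T4Family) (D : Datum F N) (h : IsDatumOfRecord₁₃CCoPH F N D) (g₀ : ℕ → ℝ) (os : List (ULoop F)) (k : ℕ),
      RatesAt D (rateCarriersOfRecord₁₃CoPH 𝔯 F h.params h.provisos g₀ os k) → letI := (cr F h.params h.provisos g₀ os).dec
      ∃ δ : ℕ → ℝ, NE7.Core (cr F h.params h.provisos g₀ os).l₀ (cr F h.params h.provisos g₀ os).vol (cr F h.params h.provisos g₀ os).T
        (cr F h.params h.provisos g₀ os).Bad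
        (fun K t τ => (cr F h.params h.provisos g₀ os).A K t τ - (cr F h.params h.provisos g₀ os).shA K t τ)
        (fun K t τ => (cr F h.params h.provisos g₀ os).B K t τ - (cr F h.params h.provisos g₀ os).shB K t τ) δ ∧ Summable δ)
    {F : T4Family} {D : Datum F N} {w : DagBinding.WorldP} (hR : IsRecordOfRecord₁₃CCoPH F N D w) :
    MatchingUnder D (DagBinding.EndpointExistence D.C.toB12) :=
  (T4MatchingDegenerate.hybridNE7Under_iff_matchingUnder D (avgMeasurable_of_isRecordOfRecord₁₃CCoPH hR) _).mp
    (spine_of_rateStubs_coreEdge (fun F D w => IsRecordOfRecord₁₃CCoPH F N D w) (SRec₁₃CoPH (canonReading₁₃CoPH cr)) (RRec₁₃CoPH 𝔯) (s_R00x_rRec₁₃CoPH 𝔯)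
      h14 h15 h16 h17 h18 h22 hx h20 h21 ((rateEdge_canon_rRec₁₃CoPH_iff cr 𝔯).mpr h19) F D w hR)

/-- **… THE LITERAL `HybridNE7.matchingModConstants` (:183) ROAD, `lt_one` FILLED** [bookkeeping]: the same inputs plus the keyed budget half at
`cr F h.params h.provisos g₀ os` ⇒ the same conclusion through module 23's `matchingUnder_at_record₁₃CoPH_of_rateStubs`. [folklore] -/
theorem matchingUnder_at_homes₁₃CoPH_of_rateStubs_lt_one
    (h14 : S_N14 (RRec₁₃CoPH 𝔯)) (h15 : S_N15 (RRec₁₃CoPH 𝔯)) (h16 : S_N16 (RRec₁₃CoPH 𝔯)) (h17 : S_N17 (RRec₁₃CoPH 𝔯)) (h18 : S_N18 (RRec₁₃CoPH 𝔯)) (h22 : S_N22 (RRec₁₃CoPH 𝔯))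
    (hx : S_N27x (fun F D w => IsRecordOfRecord₁₃CCoPH F N D w) (SRec₁₃CoPH (canonReading₁₃CoPH cr))) (h20 : S_N20 (SRec₁₃CoPH (canonReading₁₃CoPH cr)))
    (h21 : S_N21 (SRec₁₃CoPH (canonReading₁₃CoPH cr)))
    (hlt : ∀ (F : T4Family) (D : Datum F N) (h : IsDatumOfRecord₁₃CCoPH F N D) (g₀ : ℕ → ℝ) (os : List (ULoop F)) (K : ℕ),
      (cr F h.params h.provisos g₀ os).W K + (cr F h.params h.provisos g₀ os).Wsh K < 1)
    (h19 : ∀ (F : T4Family) (D : Datum F N) (h : IsDatumOfRecord₁₃CCoPH F N D) (g₀ : ℕ → ℝ) (os : List (ULoop F)) (k : ℕ),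
      RatesAt D (rateCarriersOfRecord₁₃CoPH 𝔯 F h.params h.provisos g₀ os k) → letI := (cr F h.params h.provisos g₀ os).dec
      ∃ δ : ℕ → ℝ, NE7.Core (cr F h.params h.provisos g₀ os).l₀ (cr F h.params h.provisos g₀ os).vol (cr F h.params h.provisos g₀ os).T
        (cr F h.params h.provisos g₀ os).Bad
        (fun K t τ => (cr F h.params h.provisos g₀ os).A K t τ - (cr F h.params h.provisos g₀ os).shA K t τ)
        (fun K t τ => (cr F h.params h.provisos g₀ os).B K t τ - (cr F h.params h.provisos g₀ os).shB K t τ) δ ∧ Summable δ)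
    {F : T4Family} {D : Datum F N} {w : DagBinding.WorldP} (hR : IsRecordOfRecord₁₃CCoPH F N D w) :
    MatchingUnder D (DagBinding.EndpointExistence D.C.toB12) :=
  matchingUnder_at_record₁₃CoPH_of_rateStubs (SRec₁₃CoPH (canonReading₁₃CoPH cr)) (RRec₁₃CoPH 𝔯) (s_R00x_rRec₁₃CoPH 𝔯) h14 h15 h16 h17 h18 h22 hx h20 h21
    (by
      intro F D g₀ os S hS
      obtain ⟨h, rfl⟩ := (sRec₁₃CoPH_canon_iff cr D g₀ os S).mp hS
      exact hlt F D h g₀ os)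
    ((rateEdge_canon_rRec₁₃CoPH_iff cr 𝔯).mpr h19) hR

/-- **N21's CANONICAL TRANSFER, STAGE 13** [bookkeeping]: NE7c's `ShellWeightBound` at `cr`'s reading of EVERY admissible Stage-13 tuple with provisos gives `S_N21` at the
canonical spine home (n20-d's N20 twin is `s_N20_sRec₁₃CoPH_canon_of_sRec₁₃CoPH`). [folklore] -/
theorem s_N21_sRec₁₃CoPH_canon_of_forall
    (h21 : ∀ (F : T4Family) (θ : Stage13HParams F N) (hP : θ.Provisos₁₃CoPH F N), θ.Admissible F N → ∀ (g₀ : ℕ → ℝ) (os : List (ULoop F)),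
      ShellWeightBound (cr F θ hP g₀ os).l₀ (cr F θ hP g₀ os).T (cr F θ hP g₀ os).A (cr F θ hP g₀ os).B (cr F θ hP g₀ os).shA (cr F θ hP g₀ os).shB
        (cr F θ hP g₀ os).Wsh) :
    S_N21 (SRec₁₃CoPH (canonReading₁₃CoPH cr)) := by
  intro F D g₀ os S hS
  obtain ⟨h, rfl⟩ := (sRec₁₃CoPH_canon_iff cr D g₀ os S).mp hS
  exact h21 F h.params h.provisos h.admissible g₀ os

/-- **N27x's CANONICAL PRODUCER FROM THE KEYED EXTRACTION CLAUSE, STAGE 13** [bookkeeping]: the keyed extraction clause at EVERY admissible Stage-13 tuple with provisos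
(positivity + E1∕E2 under (B), END, small tuned couplings) gives `S_N27x ₁₃C (SRec₁₃CoPH (canonReading₁₃CoPH cr))`: at a record pair take its datum key `h`
(RR-2's `isDatumOfRecord₁₃CCoPH_of_isRecordOfRecord₁₃CCoPH`) and the bundle at `h.params`. [folklore] -/
theorem s_N27x_sRec₁₃CoPH_canon_of_forall
    (hx : ∀ (F : T4Family) (θ : Stage13HParams F N) (hP : θ.Provisos₁₃CoPH F N), θ.Admissible F N →
      B16.EndStatementBPrinted (datumOfRecord₁₃CoPH F N θ hP).C → DagBinding.EndpointExistence (datumOfRecord₁₃CoPH F N θ hP).C.toB12 →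
        ForSmallCouplings (datumOfRecord₁₃CoPH F N θ hP) fun g₀ => ∀ os : List (ULoop F),
          0 < (cr F θ hP g₀ os).l₀ ∧ 0 < (cr F θ hP g₀ os).vol ∧
          (∀ (K : ℕ) (t : ℝ), |t| ≤ (cr F θ hP g₀ os).l₀ →
            T4GenFunBounds.schemeZ ((datumOfRecord₁₃CoPH F N θ hP).scheme g₀) os ((cr F θ hP g₀ os).K₀ + K) t = ∑ τ ∈ (cr F θ hP g₀ os).T K, (cr F θ hP g₀ os).A K t τ) ∧
          (∀ (K : ℕ) (t : ℝ), |t| ≤ (cr F θ hP g₀ os).l₀ →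
            T4GenFunBounds.schemeZ ((datumOfRecord₁₃CoPH F N θ hP).scheme g₀) os ((cr F θ hP g₀ os).K₀ + K + 1) t =
              ∑ τ ∈ (cr F θ hP g₀ os).T K, (cr F θ hP g₀ os).B K t τ)) :
    S_N27x (fun F D w => IsRecordOfRecord₁₃CCoPH F N D w) (SRec₁₃CoPH (canonReading₁₃CoPH cr)) := by
  intro F D w hR hB hEnd
  have h : IsDatumOfRecord₁₃CCoPH F N D := Node00.isDatumOfRecord₁₃CCoPH_of_isRecordOfRecord₁₃CCoPH hR
  have hx' := IsDatumOfRecord₁₃CCoPH.forall_params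
    (P := fun D θ hθ => B16.EndStatementBPrinted D.C → DagBinding.EndpointExistence D.C.toB12 →
      ForSmallCouplings D fun g₀ => ∀ os : List (ULoop F),
        0 < (cr F θ hθ g₀ os).l₀ ∧ 0 < (cr F θ hθ g₀ os).vol ∧
        (∀ (K : ℕ) (t : ℝ), |t| ≤ (cr F θ hθ g₀ os).l₀ →
          T4GenFunBounds.schemeZ (D.scheme g₀) os ((cr F θ hθ g₀ os).K₀ + K) t = ∑ τ ∈ (cr F θ hθ g₀ os).T K, (cr F θ hθ g₀ os).A K t τ) ∧
        (∀ (K : ℕ) (t : ℝ), |t| ≤ (cr F θ hθ g₀ os).l₀ →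
          T4GenFunBounds.schemeZ (D.scheme g₀) os ((cr F θ hθ g₀ os).K₀ + K + 1) t = ∑ τ ∈ (cr F θ hθ g₀ os).T K, (cr F θ hθ g₀ os).B K t τ))
    (fun θ hθ hadm => hx F θ hθ hadm) h hB hEnd
  refine hx'.mono fun g₀ hg os => ?_
  obtain ⟨hl₀, hvol, hZA, hZB⟩ := hg os
  exact ⟨cr F h.params h.provisos g₀ os, (sRec₁₃CoPH_canon_iff cr D g₀ os _).mpr ⟨h, rfl⟩, hl₀, hvol, hZA, hZB⟩

/-- **N19's DECL TARGET AT BOTH STAGE-13 HOMES FROM THE CHILDREN's θ-FORM PRODUCTS** [bookkeeping]: N20's `RelWeightBound` and N21's `ShellWeightBound` at `cr F θ hP g₀ os`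
for EVERY admissible Stage-13 θ with provisos, the six in-edges BY NAME at `RRec₁₃CoPH 𝔯`, the same-key N19′ edge in θ-form at every run length, and the keyed extraction
clause ⇒ `MatchingUnder D END` at every ₁₃C record (§3 `matchingUnder_at_homes₁₃CoPH_of_rateStubs` with the canonical transfers: n20-d's `s_N20_sRec₁₃CoPH_canon_of_sRec₁₃CoPH`,
`s_N21_sRec₁₃CoPH_canon_of_forall`, `s_N27x_sRec₁₃CoPH_canon_of_forall`, `rateEdge_canon_rRec₁₃CoPH_of_forall_admissible`). [folklore] -/
theorem matchingUnder_at_homes₁₃CoPH_of_forall_admissible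
    (h20 : ∀ (F : T4Family) (θ : Stage13HParams F N) (hP : θ.Provisos₁₃CoPH F N), θ.Admissible F N → ∀ (g₀ : ℕ → ℝ) (os : List (ULoop F)),
      RelWeightBound (cr F θ hP g₀ os).l₀ (cr F θ hP g₀ os).T (cr F θ hP g₀ os).A (cr F θ hP g₀ os).B (cr F θ hP g₀ os).Bad (cr F θ hP g₀ os).W)
    (h21 : ∀ (F : T4Family) (θ : Stage13HParams F N) (hP : θ.Provisos₁₃CoPH F N), θ.Admissible F N → ∀ (g₀ : ℕ → ℝ) (os : List (ULoop F)),
      ShellWeightBound (cr F θ hP g₀ os).l₀ (cr F θ hP g₀ os).T (cr F θ hP g₀ os).A (cr F θ hP g₀ os).B (cr F θ hP g₀ os).shA (cr F θ hP g₀ os).shB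
        (cr F θ hP g₀ os).Wsh)
    (h14 : S_N14 (RRec₁₃CoPH 𝔯)) (h15 : S_N15 (RRec₁₃CoPH 𝔯)) (h16 : S_N16 (RRec₁₃CoPH 𝔯)) (h17 : S_N17 (RRec₁₃CoPH 𝔯)) (h18 : S_N18 (RRec₁₃CoPH 𝔯)) (h22 : S_N22 (RRec₁₃CoPH 𝔯))
    (h19 : ∀ (F : T4Family) (θ : Stage13HParams F N) (hP : θ.Provisos₁₃CoPH F N), θ.Admissible F N → ∀ (g₀ : ℕ → ℝ) (os : List (ULoop F)) (k : ℕ),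
      RatesAt (datumOfRecord₁₃CoPH F N θ hP) (rateCarriersOfRecord₁₃CoPH 𝔯 F θ hP g₀ os k) → letI := (cr F θ hP g₀ os).dec
      ∃ δ : ℕ → ℝ, NE7.Core (cr F θ hP g₀ os).l₀ (cr F θ hP g₀ os).vol (cr F θ hP g₀ os).T (cr F θ hP g₀ os).Bad
        (fun K t τ => (cr F θ hP g₀ os).A K t τ - (cr F θ hP g₀ os).shA K t τ) (fun K t τ => (cr F θ hP g₀ os).B K t τ - (cr F θ hP g₀ os).shB K t τ) δ ∧
        Summable δ)
    (hx : ∀ (F : T4Family) (θ : Stage13HParams F N) (hP : θ.Provisos₁₃CoPH F N), θ.Admissible F N →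
      B16.EndStatementBPrinted (datumOfRecord₁₃CoPH F N θ hP).C → DagBinding.EndpointExistence (datumOfRecord₁₃CoPH F N θ hP).C.toB12 →
        ForSmallCouplings (datumOfRecord₁₃CoPH F N θ hP) fun g₀ => ∀ os : List (ULoop F),
          0 < (cr F θ hP g₀ os).l₀ ∧ 0 < (cr F θ hP g₀ os).vol ∧
          (∀ (K : ℕ) (t : ℝ), |t| ≤ (cr F θ hP g₀ os).l₀ →
            T4GenFunBounds.schemeZ ((datumOfRecord₁₃CoPH F N θ hP).scheme g₀) os ((cr F θ hP g₀ os).K₀ + K) t = ∑ τ ∈ (cr F θ hP g₀ os).T K, (cr F θ hP g₀ os).A K t τ) ∧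
          (∀ (K : ℕ) (t : ℝ), |t| ≤ (cr F θ hP g₀ os).l₀ →
            T4GenFunBounds.schemeZ ((datumOfRecord₁₃CoPH F N θ hP).scheme g₀) os ((cr F θ hP g₀ os).K₀ + K + 1) t =
              ∑ τ ∈ (cr F θ hP g₀ os).T K, (cr F θ hP g₀ os).B K t τ))
    {F : T4Family} {D : Datum F N} {w : DagBinding.WorldP} (hR : IsRecordOfRecord₁₃CCoPH F N D w) :
    MatchingUnder D (DagBinding.EndpointExistence D.C.toB12) :=
  matchingUnder_at_homes₁₃CoPH_of_rateStubs cr 𝔯 h14 h15 h16 h17 h18 h22 (s_N27x_sRec₁₃CoPH_canon_of_forall cr hx)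
    (s_N20_sRec₁₃CoPH_canon_of_sRec₁₃CoPH cr ((s_N20_sRec₁₃CoPH_iff cr).mpr h20)) (s_N21_sRec₁₃CoPH_canon_of_forall cr h21)
    ((rateEdge_canon_rRec₁₃CoPH_iff cr 𝔯).mp (rateEdge_canon_rRec₁₃CoPH_of_forall_admissible cr 𝔯 h19)) hR

end Target

/-! ## §3′ The guarded θ-keyed B5 form (rev 16's K3‴ shape, any guard `G`) READ OFF THE STAGE-13 HOMES -/

section Guarded

/-- **K3′'s GUARDED θ-KEYED BODY FROM THE STUBS AT THE TWO STAGE-13 HOMES** [bookkeeping]: §3 `matchingUnder_at_homes₁₃CoPH_of_rateStubs` gives N19's target at every ₁₃C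
record; module 23's guarded faces turn it into «for every guard `G` (e.g. RR-2's guard of record `Node00.unityNondeg₁₃ N`), every admissible Stage-13 θ with provisos and
`G θ`: `HybridNE7Under (datumOfRecord₁₃CoPH F N θ h) END`» — the shape of rev 16's K3‴ text (a guard only weakens; B5 = U5 at the datum by B1). [folklore] -/
theorem hybridNE7Under_guarded_datumOfRecord₁₃CoPH_of_rateStubs_at_homes₁₃CoPH (G : ∀ {F : T4Family}, Stage13HParams F N → Prop)
    (h14 : S_N14 (RRec₁₃CoPH 𝔯)) (h15 : S_N15 (RRec₁₃CoPH 𝔯)) (h16 : S_N16 (RRec₁₃CoPH 𝔯)) (h17 : S_N17 (RRec₁₃CoPH 𝔯)) (h18 : S_N18 (RRec₁₃CoPH 𝔯)) (h22 : S_N22 (RRec₁₃CoPH 𝔯))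
    (hx : S_N27x (fun F D w => IsRecordOfRecord₁₃CCoPH F N D w) (SRec₁₃CoPH (canonReading₁₃CoPH cr))) (h20 : S_N20 (SRec₁₃CoPH (canonReading₁₃CoPH cr)))
    (h21 : S_N21 (SRec₁₃CoPH (canonReading₁₃CoPH cr)))
    (h19 : ∀ (F : T4Family) (D : Datum F N) (h : IsDatumOfRecord₁₃CCoPH F N D) (g₀ : ℕ → ℝ) (os : List (ULoop F)) (k : ℕ),
      RatesAt D (rateCarriersOfRecord₁₃CoPH 𝔯 F h.params h.provisos g₀ os k) → letI := (cr F h.params h.provisos g₀ os).dec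
      ∃ δ : ℕ → ℝ, NE7.Core (cr F h.params h.provisos g₀ os).l₀ (cr F h.params h.provisos g₀ os).vol (cr F h.params h.provisos g₀ os).T
        (cr F h.params h.provisos g₀ os).Bad
        (fun K t τ => (cr F h.params h.provisos g₀ os).A K t τ - (cr F h.params h.provisos g₀ os).shA K t τ)
        (fun K t τ => (cr F h.params h.provisos g₀ os).B K t τ - (cr F h.params h.provisos g₀ os).shB K t τ) δ ∧ Summable δ)
    (F : T4Family) (θ : Stage13HParams F N) (hP : θ.Provisos₁₃CoPH F N) (hG : G θ) (hθ : θ.Admissible F N) :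
    T4ApexHybrid.HybridNE7Under (datumOfRecord₁₃CoPH F N θ hP) (DagBinding.EndpointExistence (datumOfRecord₁₃CoPH F N θ hP).C.toB12) :=
  (forall_guarded_matchingUnder_datumOfRecord₁₃CoPH_iff G).mp
    (forall_guarded_matchingUnder_datumOfRecord₁₃CoPH_of_forall_record₁₃CoPH G
      fun _ _ _ hR => matchingUnder_at_homes₁₃CoPH_of_rateStubs cr 𝔯 h14 h15 h16 h17 h18 h22 hx h20 h21 h19 hR)
    F θ hP hG hθ

end Guarded

end Summit.QuantumFields.YangMills.BalabanUVNodes.N19TargetAtHomes13CoPH
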